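import Summits.CriticalPhenomena.PercolationContinuityZ3.Theorems.SahiBoxTP2Real
import Summits.CriticalPhenomena.PercolationContinuityZ3.Theorems.PercNearOneGluingNoHeavyLowerTailSahiGridThree

/-!
# Order 3 in dimension ≤ 3: every box-TP₂ law on `[0,1]³` satisfies Sahi's `C₃` (computational certificate inside)

Support file of the Sahi cell (`prim-sahi`, typer seat, generation 11; `--supports stmt-CriticalPhenomena-4575`).
COMPUTATIONAL: depends on `SahiGrid3.liebSahiContinuum_three_three` (seat P1, generation 6), whose proof contains the
declared `native_decide` certificate of the `[3]³` pattern inequality; everything else is kernel-only.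

* `msahiE_nonneg_of_isBoxTP2_of_dim_le_three_three` — for every `d ≤ 3`, every box-TP₂ probability measure `μ` on
  `Q_d` (singular laws allowed) and all measurable nonnegative monotone `f, g, h : Q_d → ℝ`:
  `E₃(f,g,h) = 2⟨fgh⟩ + ⟨f⟩⟨g⟩⟨h⟩ − ⟨f⟩⟨gh⟩ − ⟨g⟩⟨fh⟩ − ⟨h⟩⟨fg⟩ ≥ 0` (`⟨·⟩ = ∫ · dμ`); antitone twin.
* `msahiE_nonneg_of_isBoxTP2_real_of_dim_le_three_three` — the same on `ℝ^d`, `d ≤ 3`, bounded families; e.g.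
  (`msahiE_withDensity_pi_real_three_nonneg`) every probability law on `ℝ^d`, `d ≤ 3`, with a measurable MTP₂ density
  with respect to a product of σ-finite reference measures (Gaussian vectors with M-matrix precision, discrete MTP₂
  laws on `ℤ³`, …) satisfies `E₃(f,g,h) ≥ 0` for bounded measurable nonnegative monotone `f, g, h`.
So the proved region of "box-TP₂ law on `Q_d` / `ℝ^d` is Sahi-positive of order `n`" is
`{d ≤ 2} ∪ {n ≤ 2} ∪ {d ≤ 3, n = 3}` (`SahiBoxTP2Positivity.lean` / `SahiBoxTP2Real.lean` for the first two).
No sorries; axioms standard + the declared certificate.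
-/

noncomputable section

namespace Summit.CriticalPhenomena.PercolationContinuityZ3.Theorems.SahiBoxTP2

open MeasureTheory Literature.Combinatorics.Sahi2008
open scoped unitInterval ENNReal

variable {d : ℕ}

/-- **`C₃` for every box-TP₂ law on `Q_d`, `d ≤ 3`** (measurable nonnegative monotone triples; singular laws
allowed). COMPUTATIONAL via `SahiGrid3.liebSahiContinuum_of_dim_le_three_three`. [this work] -/
theorem msahiE_nonneg_of_isBoxTP2_of_dim_le_three_three (hd : d ≤ 3) (μ : Measure (Fin d → I))
    [IsProbabilityMeasure μ] (hμ : IsBoxTP2 μ) (f : Fin 3 → (Fin d → I) → ℝ) (hfm : ∀ i, Measurable (f i))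
    (hf0 : ∀ i x, 0 ≤ f i x) (hmono : ∀ i, Monotone (f i)) : 0 ≤ msahiE μ 3 f :=
  msahiE_nonneg_of_isBoxTP2 (SahiGrid3.liebSahiContinuum_of_dim_le_three_three hd) μ hμ f hfm hf0 hmono

/-- The antitone twin (Lieb–Sahi's decreasing functions). COMPUTATIONAL. [this work] -/
theorem msahiE_nonneg_of_isBoxTP2_of_dim_le_three_three_antitone (hd : d ≤ 3) (μ : Measure (Fin d → I))
    [IsProbabilityMeasure μ] (hμ : IsBoxTP2 μ) (f : Fin 3 → (Fin d → I) → ℝ) (hfm : ∀ i, Measurable (f i))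
    (hf0 : ∀ i x, 0 ≤ f i x) (hanti : ∀ i, Antitone (f i)) : 0 ≤ msahiE μ 3 f :=
  msahiE_nonneg_of_isBoxTP2_antitone (SahiGrid3.liebSahiContinuum_of_dim_le_three_three hd) μ hμ f hfm hf0 hanti

/-- **Displayed form on the cube `[0,1]³`**: for a box-TP₂ probability measure `μ` and measurable nonnegative
monotone `f, g, h`, `0 ≤ 2∫fgh + ∫f∫g∫h − ∫f∫gh − ∫g∫fh − ∫h∫fg`. COMPUTATIONAL. [this work] -/
theorem sahiC3_of_isBoxTP2_cube (μ : Measure (Fin 3 → I)) [IsProbabilityMeasure μ] (hμ : IsBoxTP2 μ)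
    (f g h : (Fin 3 → I) → ℝ) (hf : Measurable f) (hg : Measurable g) (hh : Measurable h) (hf0 : ∀ x, 0 ≤ f x)
    (hg0 : ∀ x, 0 ≤ g x) (hh0 : ∀ x, 0 ≤ h x) (hfm : Monotone f) (hgm : Monotone g) (hhm : Monotone h) :
    0 ≤ 2 * (∫ x, f x * g x * h x ∂μ) + (∫ x, f x ∂μ) * (∫ x, g x ∂μ) * (∫ x, h x ∂μ) -
      ((∫ x, f x ∂μ) * (∫ x, g x * h x ∂μ) + (∫ x, g x ∂μ) * (∫ x, f x * h x ∂μ) +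
        (∫ x, h x ∂μ) * (∫ x, f x * g x ∂μ)) := by
  have key := msahiE_nonneg_of_isBoxTP2_of_dim_le_three_three le_rfl μ hμ ![f, g, h]
    (fun i => by fin_cases i <;> assumption) (fun i => by fin_cases i <;> assumption)
    (fun i => by fin_cases i <;> assumption)
  rwa [msahiE_three] at key

/-- **`C₃` for every box-TP₂ law on `ℝ^d`, `d ≤ 3`** (bounded measurable nonnegative monotone triples).
COMPUTATIONAL. [this work] -/
theorem msahiE_nonneg_of_isBoxTP2_real_of_dim_le_three_three (hd : d ≤ 3) (ν : Measure (Fin d → ℝ))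
    [IsProbabilityMeasure ν] (hν : IsBoxTP2 ν) (f : Fin 3 → (Fin d → ℝ) → ℝ) (hfm : ∀ i, Measurable (f i))
    (hf0 : ∀ i x, 0 ≤ f i x) {M : ℝ} (hfM : ∀ i x, f i x ≤ M) (hmono : ∀ i, Monotone (f i)) :
    0 ≤ msahiE ν 3 f :=
  msahiE_nonneg_of_isBoxTP2_real (SahiGrid3.liebSahiContinuum_of_dim_le_three_three hd) ν hν f hfm hf0 hfM hmono

/-- The antitone twin on `ℝ^d`, `d ≤ 3`. COMPUTATIONAL. [this work] -/
theorem msahiE_nonneg_of_isBoxTP2_real_of_dim_le_three_three_antitone (hd : d ≤ 3) (ν : Measure (Fin d → ℝ))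
    [IsProbabilityMeasure ν] (hν : IsBoxTP2 ν) (f : Fin 3 → (Fin d → ℝ) → ℝ) (hfm : ∀ i, Measurable (f i))
    (hf0 : ∀ i x, 0 ≤ f i x) {M : ℝ} (hfM : ∀ i x, f i x ≤ M) (hanti : ∀ i, Antitone (f i)) :
    0 ≤ msahiE ν 3 f :=
  msahiE_nonneg_of_isBoxTP2_real_antitone (SahiGrid3.liebSahiContinuum_of_dim_le_three_three hd) ν hν f hfm hf0
    hfM hanti

/-- **`C₃` for every MTP₂ density on `ℝ^d`, `d ≤ 3`, with respect to any product of σ-finite reference measures**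
(e.g. centred or non-centred Gaussian vectors whose precision matrix has nonpositive off-diagonal entries, for
Lebesgue reference; discrete MTP₂ laws for counting reference on `ℤ ⊂ ℝ`): `E₃(f,g,h) ≥ 0` for bounded
measurable nonnegative monotone `f, g, h`. COMPUTATIONAL. [this work] -/
theorem msahiE_withDensity_pi_real_three_nonneg (hd : d ≤ 3) (μ : Fin d → Measure ℝ) [∀ i, SigmaFinite (μ i)]
    (ρ : (Fin d → ℝ) → ℝ≥0∞) (hρm : Measurable ρ) (hρ : ∀ x y, ρ x * ρ y ≤ ρ (x ⊔ y) * ρ (x ⊓ y))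
    [IsProbabilityMeasure ((Measure.pi μ).withDensity ρ)] (f : Fin 3 → (Fin d → ℝ) → ℝ)
    (hfm : ∀ i, Measurable (f i)) (hf0 : ∀ i x, 0 ≤ f i x) {M : ℝ} (hfM : ∀ i x, f i x ≤ M)
    (hmono : ∀ i, Monotone (f i)) : 0 ≤ msahiE ((Measure.pi μ).withDensity ρ) 3 f :=
  msahiE_nonneg_of_isBoxTP2_real_of_dim_le_three_three hd _ (IsBoxTP2.withDensity_pi μ ρ hρm hρ) f hfm hf0 hfM
    hmono

end Summit.CriticalPhenomena.PercolationContinuityZ3.Theorems.SahiBoxTP2
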